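import Literature.AnabelianGeometry.EtaleTheta.TemperedFrobenioidOfThetaTwistTower
import HarnessLib

/-!
# [EtTh] Def. 4.1 (i) / [FrdI] Prop. 4.1 (iii): the coprimality-pull-back law `hDSpull` (`TemperedFrobenioid.CoprimePullLaw`)
# HOLDS at the FOURTH tower model of record — the tempered Frobenioid of the ε-free (β) theta tower over the FULL base
# `B^temp(Compat₃′)⁰` — and at every tempered Frobenioid built by the ramified-uniformiser engine `ofPowDiagonalBase`

S. Mochizuki, *The étale theta function and its Frobenioid-theoretic manifestations*, Publ. RIMS **45** (2009) [MochizukiEtTh2009],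
Def. 3.1 (i) p.70, Def. 3.3 (iii) p.73–74, Def. 3.6 (ii) p.76–77, §4 Def. 4.1 (i) p.86 («`Div(s′)`, `Div(s″)` have disjoint supports
[cf. [FrdI], Proposition 4.1, (iii)]»), proof of Prop. 4.2 (iii) pp.89–90 [cite: MochizukiEtTh2009, Def 4.1 (i) p.86]; [FrdI] =
[MochizukiFrdI2008] §0 p.11 (`M^pf`), Def. 2.4 (i) p.47, Prop. 4.1 (iii) p.74.

abc-iut cell, layer L2 [EtTh]; seat abc-iut-w6-d037 (gen 6), row «P42III-POSITIVE@FOURTH-MODEL» step S1.  PROOF-ONLY (0 `def`s, 0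
instances; nothing landed is edited or restated).  Consumed BY NAME: the predicate of record `TemperedFrobenioid.CoprimePullLaw`
(abc-iut-w5-d063 lineage, p466773 = GAP G-w5d063-1's binder `hDSpull`), abc-iut-L2-t3's ramified-uniformiser engine
`TemperedFrobenioid.ofPowDiagonalBase` (p491637) and its file-C calculus at the `Ÿ`-skeleton
(`TateTowerTheta.perfection_map_coprime`, `coord_pow_eq_one_iff`, `phiZeroPull_disjoint`, p4xxxxx
`TemperedFrobenioidOfTateTowerThetaCoprimePull`), abc-iut-L2-d2's fourth model `ThetaTwistTowerTempered.temperedFrobenioid` (p493549)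
with its definitional identity `phiZero_act_eq` (`Φ₀` of `ofTower towerC₃sf` IS the skeleton's `Φ₀` through `φ₃`) and transition
formula `Φ₀_map_hom_eq` («pull back, then `(−)^{eN}`»).
* §1 `TemperedFrobenioid.PowDiagonalBase.coprimePullLaw_of_perfection` — the transfer of `CoprimePullLaw` from the perfections
  `Φ₀(F A)^pf` for the engine `ofPowDiagonalBase` (the argument of abc-iut-L2-t3's `GenDiagonalBase.coprimePullLaw_of_perfection`,
  verbatim for the ramified-uniformiser engine: `Φ(A) = im(Φ₀^pf → Φ₀^rlf)` with `Φ₀^pf → Φ₀^rlf` injective);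
* §2 `ThetaTwistTowerTempered.Φ₀_map_disjoint` — along every covering map of `B^temp(Compat₃′)⁰` the transition of `Φ₀` carries
  support-disjoint pairs (cusps AND components) to support-disjoint pairs: pull-back does (`phiZeroPull_disjoint`), and so does the
  ramification power `(−)^{eN}`, `eN ≥ 1` (`coord_pow_eq_one_iff`) — the one step beyond the `Ÿ`-skeleton case;
* §3 **`ThetaTwistTowerTempered.coprimePullLaw R S : (temperedFrobenioid R S).CoprimePullLaw`** — REGISTER ✓ `hDSpull` at the fourth
  model (every vocabulary choice `R`, `S`), + the consumers' binder shape `hDSpull_temperedFrobenioid` (the `hDSpull` hypothesis of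
  the Prop. 4.2 (iii)/(iv) law-level closers, e.g. abc-iut-w6-d037's `prop42_iii_mkOfModelCanonical_trivNH_of_cyclotomicLaw`, p496075).
HONEST FRAMING: theorems about OUR typed interfaces at a class-(b) combinatorial design carrier (NOT the tempered Frobenioid of a Tate
curve); [EtTh]/[FrdI] are refereed prerequisite papers; nothing here bears on, or takes a side on, [IUTchIII] Cor. 3.12; nothing here
asserts abc proved or refuted.
-/

noncomputable section

namespace Literature.AnabelianGeometry.EtaleTheta

open CategoryTheory Opposite Function Literature.AlgebraicGeometry.Frobenioids Literature.AnabelianGeometry.SemiGraphs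
  LogDivisorModel LogDivisorModel.GaloisAction LogDivisorTower

universe u₀ v₀ u v

/-! ## §1 The transfer from the perfections, for the ramified-uniformiser engine `ofPowDiagonalBase` -/

namespace TemperedFrobenioid.PowDiagonalBase

variable {D₀ : Type u₀} [Category.{v₀} D₀] {dm : DivisorMonoids.{u₀, v₀, 0} D₀}
  (hpf : ∀ Y : D₀ᵒᵖ, IsPerfFactorialCof (dm.Φ₀.obj Y)) {D : Type u} [Category.{v} D] (P : PowDiagonalBase dm D)
  (hD : IsConnected D) (hD' : IsTotallyEpimorphic D) (hFSM : IsOfFSMType D) (R S : (Dᵒᵖ ⥤ CommMonCat.{0}) → Prop)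

/-- Every element of `Φ(A)` is the class of an element of `Φ₀(F A)^pf`. [cite: MochizukiFrdI2008, Def. 2.4(i) p.47] -/
theorem exists_eq_toRealification (A : Dᵒᵖ) (a : (ofPowDiagonalBase hpf P hD hD' hFSM R S).Φ.carrier A) :
    ∃ α : Perfection (dm.Φ₀.obj (op (P.F.obj A.unop))), (hpf (op (P.F.obj A.unop))).weak.toRealification α = a.1 :=
  a.2

/-- Divisibility in `Φ(A)` forces divisibility in `Φ₀(F A)^pf` (`M^pf → M^rlf` injective). [cite: MochizukiFrdI2008, Def. 2.4(i) p.47] -/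
theorem dvd_of_toRealification_dvd (A : Dᵒᵖ) (α β : Perfection (dm.Φ₀.obj (op (P.F.obj A.unop))))
    (a b : (ofPowDiagonalBase hpf P hD hD' hFSM R S).Φ.carrier A) (ha : (hpf (op (P.F.obj A.unop))).weak.toRealification α = a.1)
    (hb : (hpf (op (P.F.obj A.unop))).weak.toRealification β = b.1) (h : a ∣ b) : α ∣ β := by
  obtain ⟨c, hc⟩ := h
  obtain ⟨γ, hγ⟩ := exists_eq_toRealification hpf P hD hD' hFSM R S A c
  refine ⟨γ, PfImageWeak.toRealification_injective (hpf (op (P.F.obj A.unop))).weak ?_⟩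
  rw [map_mul, ha, hγ, hb]
  exact congrArg Subtype.val hc

/-- Divisibility in `Φ₀(F A)^pf` gives divisibility in `Φ(A)`. [cite: MochizukiFrdI2008, Def. 2.4(i) p.47] -/
theorem toRealification_dvd_of_dvd (A : Dᵒᵖ) (α β : Perfection (dm.Φ₀.obj (op (P.F.obj A.unop))))
    (a b : (ofPowDiagonalBase hpf P hD hD' hFSM R S).Φ.carrier A) (ha : (hpf (op (P.F.obj A.unop))).weak.toRealification α = a.1)
    (hb : (hpf (op (P.F.obj A.unop))).weak.toRealification β = b.1) (h : α ∣ β) : a ∣ b := by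
  obtain ⟨γ, rfl⟩ := h
  refine ⟨⟨(hpf (op (P.F.obj A.unop))).weak.toRealification γ, γ, rfl⟩, Subtype.ext ?_⟩
  have hm : (hpf (op (P.F.obj A.unop))).weak.toRealification (α * γ) =
      (hpf (op (P.F.obj A.unop))).weak.toRealification α * (hpf (op (P.F.obj A.unop))).weak.toRealification γ := map_mul _ _ _
  rw [hb, ha] at hm
  exact hm

/-- The pull-back of `Φ` along `f : B ⟶ A` is `Φ₀(F f)^pf` on representatives. [cite: MochizukiEtTh2009, Def 3.6 p.76] -/
theorem coe_pull {A B : D} (f : B ⟶ A) (α : Perfection (dm.Φ₀.obj (op (P.F.obj A))))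
    (a : (ofPowDiagonalBase hpf P hD hD' hFSM R S).Φ.carrier (op A)) (ha : (hpf (op (P.F.obj A))).weak.toRealification α = a.1) :
    (hpf (op (P.F.obj B))).weak.toRealification
        (Literature.AlgebraicGeometry.Frobenioids.Perfection.map (dm.Φ₀.map (P.F.map f).op).hom α) =
      (pull (ofPowDiagonalBase hpf P hD hD' hFSM R S).divisorMonoid f a).1 := by
  have h := DFunLike.congr_fun (rlfMapWeak_comp_toRealification dm.Φ₀ hpf (P.F.map f).op) α
  simp only [MonoidHom.comp_apply] at h
  rw [ha] at h
  exact h.symm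

/-- **The coprimality-pull-back law for the ramified-uniformiser engine, transferred from the perfections**: if along every arrow
`f : B ⟶ A` the map `Φ₀(F f)^pf` carries coprime pairs to coprime pairs, then `ofPowDiagonalBase …` satisfies `CoprimePullLaw`.
[cite: MochizukiEtTh2009, Def 4.1 (i) p.86] -/
theorem coprimePullLaw_of_perfection
    (H : ∀ {A B : D} (f : B ⟶ A) (α β : Perfection (dm.Φ₀.obj (op (P.F.obj A)))),
      (∀ ξ : Perfection (dm.Φ₀.obj (op (P.F.obj A))), ξ ∣ α → ξ ∣ β → ξ = 1) →
        ∀ η : Perfection (dm.Φ₀.obj (op (P.F.obj B))),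
          η ∣ Literature.AlgebraicGeometry.Frobenioids.Perfection.map (dm.Φ₀.map (P.F.map f).op).hom α →
          η ∣ Literature.AlgebraicGeometry.Frobenioids.Perfection.map (dm.Φ₀.map (P.F.map f).op).hom β → η = 1) :
    (ofPowDiagonalBase hpf P hD hD' hFSM R S).CoprimePullLaw := by
  intro A B f a b hab y hya hyb
  obtain ⟨α, hα⟩ := exists_eq_toRealification hpf P hD hD' hFSM R S (op A) a
  obtain ⟨β, hβ⟩ := exists_eq_toRealification hpf P hD hD' hFSM R S (op A) b
  obtain ⟨η, hη⟩ := exists_eq_toRealification hpf P hD hD' hFSM R S (op B) y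
  have hαβ : ∀ ξ : Perfection (dm.Φ₀.obj (op (P.F.obj A))), ξ ∣ α → ξ ∣ β → ξ = 1 := by
    intro ξ hξα hξβ
    have hx : (⟨(hpf (op (P.F.obj A))).weak.toRealification ξ, ξ, rfl⟩ :
        (ofPowDiagonalBase hpf P hD hD' hFSM R S).Φ.carrier (op A)) = 1 :=
      hab _ (toRealification_dvd_of_dvd hpf P hD hD' hFSM R S (op A) ξ α _ a rfl hα hξα)
        (toRealification_dvd_of_dvd hpf P hD hD' hFSM R S (op A) ξ β _ b rfl hβ hξβ)
    refine PfImageWeak.toRealification_injective (hpf (op (P.F.obj A))).weak ?_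
    rw [map_one]
    exact congrArg Subtype.val hx
  have hηα : η ∣ Literature.AlgebraicGeometry.Frobenioids.Perfection.map (dm.Φ₀.map (P.F.map f).op).hom α :=
    dvd_of_toRealification_dvd hpf P hD hD' hFSM R S (op B) η _ y _ hη (coe_pull hpf P hD hD' hFSM R S f α a hα) hya
  have hηβ : η ∣ Literature.AlgebraicGeometry.Frobenioids.Perfection.map (dm.Φ₀.map (P.F.map f).op).hom β :=
    dvd_of_toRealification_dvd hpf P hD hD' hFSM R S (op B) η _ y _ hη (coe_pull hpf P hD hD' hFSM R S f β b hβ) hyb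
  have hη1 : η = 1 := H f α β hαβ η hηα hηβ
  apply Subtype.ext
  change y.1 = 1
  rw [← hη, hη1, map_one]
  rfl

end TemperedFrobenioid.PowDiagonalBase

/-! ## §2 At the fourth model: transitions of `Φ₀` preserve disjointness of supports (pull-back, then `(−)^{eN}`) -/

namespace ThetaTwistTowerTempered

open LogDivisorModel.TateTowerThetaTwist TateTowerKummerTwistRShear

/-- **Along every covering map of `B^temp(Compat₃′)⁰` the transition of `Φ₀` carries support-disjoint pairs (cusps and components) to
support-disjoint pairs**: the transition is «pull back along the map of `Compat₃′`-sets, then raise to the ramification index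
`eN ≥ 1`» (`Φ₀_map_hom_eq`); pull-back moves coordinates to coordinates and positive powers have the same support.
[cite: MochizukiEtTh2009, Def 4.1 (i) p.86] -/
theorem Φ₀_map_disjoint {A B : ConnectedPart (BTemp (Compat 3 thetaShear))} (f : B ⟶ A) (a b : dm.Φ₀.obj (op A))
    (h : ∀ (s : (gset A).V) (x : TateTowerTheta.Idx),
      TateTowerTheta.coord φ₃ (gset A) s x a = 1 ∨ TateTowerTheta.coord φ₃ (gset A) s x b = 1)
    (s : (gset B).V) (x : TateTowerTheta.Idx) :
    TateTowerTheta.coord φ₃ (gset B) s x ((dm.Φ₀.map f.op).hom a) = 1 ∨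
      TateTowerTheta.coord φ₃ (gset B) s x ((dm.Φ₀.map f.op).hom b) = 1 := by
  rw [Φ₀_map_hom_eq, Φ₀_map_hom_eq, TateTowerTheta.coord_pow_eq_one_iff φ₃ _ (eN_lvl_pos f.op),
    TateTowerTheta.coord_pow_eq_one_iff φ₃ _ (eN_lvl_pos f.op)]
  exact TateTowerTheta.phiZeroPull_disjoint φ₃ _ _ a b h s x

variable (R S : ((ConnectedPart (BTemp (Compat 3 thetaShear)))ᵒᵖ ⥤ CommMonCat.{0}) → Prop)

/-! ## §3 REGISTER ✓ — `hDSpull` at the tempered Frobenioid of the ε-free theta tower over the full base -/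

/-- **REGISTER ✓ — the coprimality-pull-back law `hDSpull` ([FrdI] Prop. 4.1 (iii); GAP G-w5d063-1's binder) HOLDS at the FOURTH
tower model of record `ThetaTwistTowerTempered.temperedFrobenioid R S`** (every vocabulary choice `R`, `S`): disjoint supports pull
back to disjoint supports (§2) and the law transfers from the perfections (§1). [cite: MochizukiEtTh2009, Def 4.1 (i) p.86] -/
theorem coprimePullLaw : (ThetaTwistTowerTempered.temperedFrobenioid R S).CoprimePullLaw :=
  TemperedFrobenioid.PowDiagonalBase.coprimePullLaw_of_perfection hpf powDiagonalBase _ _ _ R S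
    fun f α β hαβ η hηα hηβ =>
      TateTowerTheta.perfection_map_coprime φ₃ _ _ (fun a b h => Φ₀_map_disjoint f a b h) α β hαβ η hηα hηβ

/-- The law in the consumers' binder shape (`hDSpull` of the Prop. 4.2 (iii)/(iv) law-level closers at `mkOfModelCanonical`, e.g.
`Prop42Sub.prop42_iii_mkOfModelCanonical_trivNH_of_cyclotomicLaw`) at the fourth model. [cite: MochizukiEtTh2009, Prop 4.2 (iii) p.89] -/
theorem hDSpull_temperedFrobenioid {A A' : ConnectedPart (BTemp (Compat 3 thetaShear))} (e : A' ⟶ A)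
    {a b : (temperedFrobenioid R S).Φ.carrier (op A)}
    (hab : ∀ x : (temperedFrobenioid R S).Φ.carrier (op A), x ∣ a → x ∣ b → x = 1)
    (y : (temperedFrobenioid R S).Φ.carrier (op A')) (hya : y ∣ pull (temperedFrobenioid R S).divisorMonoid e a)
    (hyb : y ∣ pull (temperedFrobenioid R S).divisorMonoid e b) : y = 1 :=
  coprimePullLaw R S e hab y hya hyb

end ThetaTwistTowerTempered

end Literature.AnabelianGeometry.EtaleTheta

end
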